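import Literature.NumberTheory.LFunctions.WeilExplicit
import Mathlib.Analysis.SpecialFunctions.Integrals.Basic
import HarnessLib

/-!
# HANDOFF — the transform of a CUT-OFF COSINE POLYNOMIAL (rh-explicit, track «HANDOFF», seat prove-2 gen8, ATTEMPT-16 Lemma A1 (i))

HONEST FRAMING. Nothing here bears on the truth of RH. ATTEMPT-16 (HOME/handoff/prove-2/ATTEMPT-16.md) proves the RH-free wall
ceiling `δ*(q) < (1/50)(log q)^{3/2}q^{−3/2}` (`q ≥ 10⁴`) at paper level; its witness is a mollified CUT-OFF COSINE POLYNOMIAL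
`F₀(x) = (1/2b)[1 + 2Σ_{k≤K} a_k cos(ℓ_k x)]·1_{[−b,b]}(x)`, `ℓ_k = πk/b`, and the first step of the proof (Lemma A1 (i)) is the
elementary computation of its transform on the critical line:
`∫_{−b}^{b} F₀(x)e^{iξx}dx = (sin bξ/(bξ))·[1 + 2Σ_k (−1)^k a_k ξ²/(ξ² − ℓ_k²)]` (`ξ ∉ {0, ±ℓ_k}`).
This file is that computation in the kernel (`weilMellin_cutoffCosPoly`): the first brick of a Lean proof of the typed claim
`DodgerZeroSumClaim` (`HandoffDodgerZeroSumReduction`). Ingredients: `integral_exp_mul_complex`, `Complex.sin_antiperiodic`.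
No `sorry`, standard axioms.

References: this track (ATTEMPT-16 §2). Folklore calculus.
-/

set_option linter.dupNamespace false

noncomputable section

open Complex MeasureTheory Set intervalIntegral Literature.NumberTheory.LFunctions
open scoped Real

namespace Summit.RiemannHypothesis.RiemannHypothesis.Theorems.Handoff

/-- The lattice frequency `ℓ_k = πk/b` of the window `[−b, b]`. [this track, ATTEMPT-16 §1] -/
def latticeFreq (b : ℝ) (k : ℕ) : ℝ := π * k / b

/-- The CUT-OFF COSINE POLYNOMIAL `F(x) = (1/2b)(1 + 2 Σ_{k=1}^{K} a_k cos(ℓ_k x))` on `[−b, b]`, `0` outside — the shape of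
ATTEMPT-16's dodger `F₀` (there `a_k = E(ℓ_k)`). [this track, ATTEMPT-16 §1] -/
def cutoffCosPoly (b : ℝ) (K : ℕ) (a : ℕ → ℝ) : ℝ → ℂ :=
  (Icc (-b) b).indicator fun x ↦
    (((1 / (2 * b)) * (1 + 2 * ∑ k ∈ Finset.range K, a (k + 1) * Real.cos (latticeFreq b (k + 1) * x)) : ℝ) : ℂ)

/-- On the critical line the Weil–Mellin transform of a function cut off to `[−b, b]` is the interval integral
`∫_{−b}^{b} f(t)e^{iξt}dt`. [folklore] -/
theorem weilMellin_indicator_Icc (f : ℝ → ℂ) {b : ℝ} (hb : 0 ≤ b) (ξ : ℂ) :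
    weilMellin ((Icc (-b) b).indicator f) (1 / 2 + I * ξ) = ∫ t in (-b)..b, f t * cexp (I * ξ * t) := by
  unfold weilMellin
  have hfun : (fun t : ℝ ↦ (Icc (-b) b).indicator f t * cexp ((1 / 2 + I * ξ - 1 / 2) * t)) =
      (Icc (-b) b).indicator (fun t ↦ f t * cexp (I * ξ * t)) := by
    funext t
    rw [show (1 / 2 + I * ξ - 1 / 2 : ℂ) = I * ξ by ring]
    by_cases ht : t ∈ Icc (-b) b
    · simp [Set.indicator_of_mem ht]
    · simp [Set.indicator_of_notMem ht]
  rw [hfun, MeasureTheory.integral_indicator measurableSet_Icc,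
    MeasureTheory.integral_Icc_eq_integral_Ioc, ← intervalIntegral.integral_of_le (by linarith)]

/-- `∫_{−b}^{b} e^{ict} dt = 2 sin(cb)/c` for complex `c ≠ 0`. [folklore] -/
theorem integral_cexp_I_mul {c : ℂ} (hc : c ≠ 0) (b : ℝ) :
    ∫ t in (-b)..b, cexp (I * c * t) = 2 * Complex.sin (c * b) / c := by
  have hIc : I * c ≠ 0 := mul_ne_zero I_ne_zero hc
  rw [integral_exp_mul_complex (a := -b) (b := b) hIc]
  have e1 : I * c * (b : ℂ) = (c * b) * I := by ring
  have e2 : I * c * ((-b : ℝ) : ℂ) = -(c * b) * I := by push_cast; ring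
  rw [e1, e2, Complex.sin, div_eq_div_iff hIc hc]
  ring_nf
  rw [Complex.I_sq]
  ring

/-- `∫_{−b}^{b} cos(ℓt)·e^{iξt} dt = sin((ξ+ℓ)b)/(ξ+ℓ) + sin((ξ−ℓ)b)/(ξ−ℓ)` for `ξ ≠ ±ℓ`. [folklore] -/
theorem integral_cos_mul_cexp {ξ : ℂ} {ℓ : ℝ} (h1 : ξ + ℓ ≠ 0) (h2 : ξ - ℓ ≠ 0) (b : ℝ) :
    ∫ t in (-b)..b, (Real.cos (ℓ * t) : ℂ) * cexp (I * ξ * t) =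
      Complex.sin ((ξ + ℓ) * b) / (ξ + ℓ) + Complex.sin ((ξ - ℓ) * b) / (ξ - ℓ) := by
  have hsplit : ∀ t : ℝ, (Real.cos (ℓ * t) : ℂ) * cexp (I * ξ * t) =
      (1 / 2 : ℂ) * cexp (I * (ξ + ℓ) * t) + (1 / 2 : ℂ) * cexp (I * (ξ - ℓ) * t) := by
    intro t
    rw [Complex.ofReal_cos, Complex.cos]
    push_cast
    rw [show I * (ξ + ℓ) * (t : ℂ) = I * ξ * t + ℓ * t * I by ring,
      show I * (ξ - ℓ) * (t : ℂ) = I * ξ * t + -(ℓ * t) * I by ring, Complex.exp_add, Complex.exp_add]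
    ring
  simp_rw [hsplit]
  have hi1 : IntervalIntegrable (fun t : ℝ ↦ (1 / 2 : ℂ) * cexp (I * (ξ + ℓ) * t)) volume (-b) b :=
    (Continuous.intervalIntegrable (by fun_prop) _ _)
  have hi2 : IntervalIntegrable (fun t : ℝ ↦ (1 / 2 : ℂ) * cexp (I * (ξ - ℓ) * t)) volume (-b) b :=
    (Continuous.intervalIntegrable (by fun_prop) _ _)
  rw [intervalIntegral.integral_add hi1 hi2, intervalIntegral.integral_const_mul, intervalIntegral.integral_const_mul,
    integral_cexp_I_mul h1, integral_cexp_I_mul h2]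
  ring

/-- At a lattice frequency the two sines fold: `sin((ξ ± ℓ_k)b) = (−1)^k sin(ξb)` (`ℓ_k b = πk`), so
`∫_{−b}^{b} cos(ℓ_k t)e^{iξt}dt = (−1)^k·sin(bξ)·2ξ/(ξ² − ℓ_k²)`. [this track, ATTEMPT-16 Lemma A1 (i)] -/
theorem integral_cos_latticeFreq_mul_cexp {b : ℝ} (hb : b ≠ 0) {ξ : ℂ} (k : ℕ)
    (h1 : ξ + latticeFreq b k ≠ 0) (h2 : ξ - latticeFreq b k ≠ 0) :
    ∫ t in (-b)..b, (Real.cos (latticeFreq b k * t) : ℂ) * cexp (I * ξ * t) =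
      (-1) ^ k * Complex.sin (b * ξ) * (2 * ξ / (ξ ^ 2 - (latticeFreq b k : ℂ) ^ 2)) := by
  rw [integral_cos_mul_cexp h1 h2]
  have hb' : (b : ℂ) ≠ 0 := by exact_mod_cast hb
  have hl : ((latticeFreq b k : ℝ) : ℂ) * b = k * π := by
    simp only [latticeFreq]
    push_cast
    field_simp
  have s1 : Complex.sin ((ξ + latticeFreq b k) * b) = (-1) ^ k * Complex.sin (b * ξ) := by
    rw [add_mul, hl, show (b : ℂ) * ξ = ξ * b by ring]
    exact Complex.sin_antiperiodic.add_nat_mul_eq k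
  have s2 : Complex.sin ((ξ - latticeFreq b k) * b) = (-1) ^ k * Complex.sin (b * ξ) := by
    rw [sub_mul, hl, show (b : ℂ) * ξ = ξ * b by ring]
    exact Complex.sin_antiperiodic.sub_nat_mul_eq k
  rw [s1, s2]
  have hsq : ξ ^ 2 - (latticeFreq b k : ℂ) ^ 2 = (ξ + latticeFreq b k) * (ξ - latticeFreq b k) := by ring
  rw [hsq]
  field_simp
  ring

/-- **The transform of the cut-off cosine polynomial on the line (ATTEMPT-16 Lemma A1 (i)):**
`weilMellin F (½ + iξ) = ∫_{−b}^{b}F(t)e^{iξt}dt = (sin(bξ)/(bξ))·[1 + 2Σ_{k=1}^{K}(−1)^k a_k ξ²/(ξ² − ℓ_k²)]`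
for `b > 0` and `ξ ∉ {0, ±ℓ_1, …, ±ℓ_K}`. [this track, ATTEMPT-16 Lemma A1 (i)] -/
theorem weilMellin_cutoffCosPoly {b : ℝ} (hb : 0 < b) (K : ℕ) (a : ℕ → ℝ) {ξ : ℂ} (hξ : ξ ≠ 0)
    (hξ1 : ∀ k ∈ Finset.range K, ξ + latticeFreq b (k + 1) ≠ 0)
    (hξ2 : ∀ k ∈ Finset.range K, ξ - latticeFreq b (k + 1) ≠ 0) :
    weilMellin (cutoffCosPoly b K a) (1 / 2 + I * ξ) =
      Complex.sin (b * ξ) / (b * ξ) *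
        (1 + 2 * ∑ k ∈ Finset.range K,
          (-1) ^ (k + 1) * (a (k + 1) : ℂ) * (ξ ^ 2 / (ξ ^ 2 - (latticeFreq b (k + 1) : ℂ) ^ 2))) := by
  have hb' : (b : ℂ) ≠ 0 := by exact_mod_cast hb.ne'
  -- Step 1: the Mellin integral over ℝ is the interval integral over [−b, b]
  rw [show cutoffCosPoly b K a = (Icc (-b) b).indicator (fun x ↦
      (((1 / (2 * b)) * (1 + 2 * ∑ k ∈ Finset.range K, a (k + 1) * Real.cos (latticeFreq b (k + 1) * x)) : ℝ) : ℂ))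
      from rfl, weilMellin_indicator_Icc _ hb.le]
  -- Step 2: expand the integrand and integrate termwise
  have hexp : ∀ t : ℝ,
      (((1 / (2 * b)) * (1 + 2 * ∑ k ∈ Finset.range K, a (k + 1) * Real.cos (latticeFreq b (k + 1) * t)) : ℝ) : ℂ) *
          cexp (I * ξ * t) =
        (1 / (2 * b) : ℂ) * cexp (I * ξ * t) +
          ∑ k ∈ Finset.range K,
            ((a (k + 1) : ℂ) / b) * ((Real.cos (latticeFreq b (k + 1) * t) : ℂ) * cexp (I * ξ * t)) := by
    intro t
    have hsum : ∑ k ∈ Finset.range K,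
        ((a (k + 1) : ℂ) / b) * ((Real.cos (latticeFreq b (k + 1) * t) : ℂ) * cexp (I * ξ * t)) =
        (cexp (I * ξ * t) / b) * ∑ k ∈ Finset.range K, (a (k + 1) : ℂ) * (Real.cos (latticeFreq b (k + 1) * t) : ℂ) := by
      rw [Finset.mul_sum]
      refine Finset.sum_congr rfl fun k _ ↦ ?_
      ring
    rw [hsum]
    push_cast
    generalize (∑ k ∈ Finset.range K, (a (k + 1) : ℂ) * Complex.cos ((latticeFreq b (k + 1) : ℂ) * (t : ℂ))) = S
    field_simp
  simp_rw [hexp]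
  have hint0 : IntervalIntegrable (fun t : ℝ ↦ (1 / (2 * b) : ℂ) * cexp (I * ξ * t)) volume (-b) b :=
    Continuous.intervalIntegrable (by fun_prop) _ _
  have hintk : ∀ k ∈ Finset.range K, IntervalIntegrable
      (fun t : ℝ ↦ ((a (k + 1) : ℂ) / b) * ((Real.cos (latticeFreq b (k + 1) * t) : ℂ) * cexp (I * ξ * t)))
      volume (-b) b :=
    fun k _ ↦ Continuous.intervalIntegrable (by fun_prop) _ _
  have hintS : IntervalIntegrable (fun t : ℝ ↦ ∑ k ∈ Finset.range K,
      ((a (k + 1) : ℂ) / b) * ((Real.cos (latticeFreq b (k + 1) * t) : ℂ) * cexp (I * ξ * t))) volume (-b) b :=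
    Continuous.intervalIntegrable (by fun_prop) _ _
  rw [intervalIntegral.integral_add hint0 hintS, intervalIntegral.integral_finsetSum hintk,
    intervalIntegral.integral_const_mul, integral_cexp_I_mul hξ]
  have hterms : ∀ k ∈ Finset.range K,
      (∫ t in (-b)..b, ((a (k + 1) : ℂ) / b) * ((Real.cos (latticeFreq b (k + 1) * t) : ℂ) * cexp (I * ξ * t))) =
        ((a (k + 1) : ℂ) / b) * ((-1) ^ (k + 1) * Complex.sin (b * ξ) *
          (2 * ξ / (ξ ^ 2 - (latticeFreq b (k + 1) : ℂ) ^ 2))) := by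
    intro k hk
    rw [intervalIntegral.integral_const_mul, integral_cos_latticeFreq_mul_cexp hb.ne' (k + 1) (hξ1 k hk) (hξ2 k hk)]
  rw [Finset.sum_congr rfl hterms]
  -- Step 3: algebra
  rw [Finset.mul_sum, mul_add, mul_one, Finset.mul_sum]
  congr 1
  · rw [show ξ * (b : ℂ) = b * ξ by ring]
    field_simp
  · refine Finset.sum_congr rfl fun k hk ↦ ?_
    have hd : ξ ^ 2 - (latticeFreq b (k + 1) : ℂ) ^ 2 ≠ 0 := by
      rw [show ξ ^ 2 - (latticeFreq b (k + 1) : ℂ) ^ 2 = (ξ + latticeFreq b (k + 1)) * (ξ - latticeFreq b (k + 1)) by ring]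
      exact mul_ne_zero (hξ1 k hk) (hξ2 k hk)
    field_simp

end Summit.RiemannHypothesis.RiemannHypothesis.Theorems.Handoff
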